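import Literature.Probability.Percolation.ArmSeparationReroute
import Literature.Combinatorics.SimpleGraph.MengerTwo
import Literature.Probability.Percolation.OneArmLSW
import HarnessLib

/-!
# The final trapezoid crossing of a clean arm, as a self-avoiding walk

Topic `Literature/Probability/Percolation`; family `crit-perc` / near-critical percolation on `𝕋`.
A brick of the near-critical arm-separation theorem for four arms in the ADJACENT colour
arrangement (P. Nolin, EJP 13 (2008), Thm. 11, `j = 4`, `σ = BBWW` [arXiv 0711.4948: Thm. 10];
the last missing input `hsepAdj` of `Werner2009_lemma63_of_altSeparation_of_adjSeparation`). The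
single-arm rerouting of the tree (`trap_reroute`, `ArmSeparationReroute.lean`) extracts from an arm
ending on the side `0` of `∂Λ_{2M}` "the final segment after its last visit to `{v₀ ≤ M}`", an open
path of the trapezoid behind side `0`, and inside it SOME open crossing of `trapDomain M`
(`JDomain.exists_crossing_subset`). The same-colour PAIR rerouting (`JDomain.pair_reroute'`,
`TriLowestCrossingReroute.lean`) needs the final segments themselves as self-avoiding walks whose
supports ARE crossings (it cuts them at prescribed vertices), which holds for CLEAN arms (meeting
`∂Λ_{2M}` only at their end, as in `adjFourArmClean`):

* `exists_final_crossing_walk` — a self-avoiding `𝕋`-walk `α : a ⇝ y` of the annulus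
  `{n ≤ |v| ≤ 2M}` with `a₀ ≤ M`, ending at `y ∈ trapO M` and meeting `∂Λ_{2M}` only at `y`, splits as
  `α = β ++ γ` at the site `q ∈ trapI M` entered right after the last visit of `{v₀ ≤ M}`; `γ` is a
  self-avoiding walk of the trapezoid and its support is a crossing of `trapDomain M` with tip `y`.

Everything here is proved; no named facts are introduced.

## References

* P. Nolin, Near-critical percolation in two dimensions, *Electron. J. Probab.* 13 (2008), §4.4,
  proof of Lemma 15 (arXiv 0711.4948: Lemma 14: "each of the `j` arms induces … a crossing of one of
  the U-shaped regions") [Nolin2008].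
* H. Kesten, *Percolation theory for mathematicians* (1982), §2.3 (crosscuts) [KestenPTM1982].

Tree: `trapD`, `trapI`, `trapO`, `trapDomain`, `mem_trapD_of_triNorm_le`, `mem_trapD`, `mem_trapI`,
`mem_trapO` (`ArmSeparationTrapezoid.lean`); `triAnnSet` (`ArmSeparationReroute.lean`);
`exists_append_last_mem`, `isPath_append_iff'` (`MengerTwo.lean`); `PathIn.of_walk_mem_support`;
`triGraph_adj_coord`, `triNorm_eq_max`. Mathlib: `SimpleGraph.Walk.exists_eq_cons_of_ne`,
`cons_isPath_iff`, `append_assoc`, `concat_eq_append`.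
-/

noncomputable section

open Set

namespace Literature.Probability.Percolation

open LatticeModels Literature.Combinatorics.SimpleGraph

/-- **The final trapezoid crossing of a clean arm.** Let `α : a ⇝ y` be a self-avoiding `𝕋`-walk
with all vertices in `{n ≤ |v| ≤ 2M}`, `a₀ ≤ M`, `y ∈ trapO M`, meeting `∂Λ_{2M}` only at `y`. Then
`α = β ++ γ` where `γ : q ⇝ y` starts at the site `q ∈ trapI M` entered just after the last visit of
`{v₀ ≤ M}`, runs inside the trapezoid `trapD M`, is self-avoiding, and its support is a crossing of
`trapDomain M` with tip `y` (it meets the tip arc `trapO M ⊆ ∂Λ_{2M}` only at `y` by cleanness). [cite: Nolin2008, §4.4 (arXiv 0711.4948: proof of Lemma 14)] -/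
theorem exists_final_crossing_walk {M n : ℕ} {a y : Site 2} (α : triGraph.Walk a y) (hα : α.IsPath)
    (hsupp : ∀ v ∈ α.support, v ∈ triAnnSet n (2 * M)) (ha0 : a 0 ≤ M) (hy : y ∈ trapO M)
    (hclean : ∀ v ∈ α.support, triNorm v = 2 * M → v = y) :
    ∃ (q : Site 2) (β : triGraph.Walk a q) (γ : triGraph.Walk q y), α = β.append γ ∧ q ∈ trapI M ∧ γ.IsPath ∧
      (∀ v ∈ γ.support, v ∈ trapD M) ∧ (∀ v ∈ γ.support, v ∈ α.support) ∧
      (trapDomain M).IsCrossing γ.support.toFinset y := by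
  classical
  have hyD : y ∈ trapD M := (mem_trapO.1 hy).1
  have hy0 : y 0 = 2 * M := (mem_trapO.1 hy).2
  have hyD' := mem_trapD.1 hyD
  -- the last vertex of `α` in `C = {v₀ ≤ M}`
  set C : Set (Site 2) := {v | v 0 ≤ M} with hC
  obtain ⟨p, β₀, γ₀, hαeq, hpC, hplast⟩ := exists_append_last_mem C α ⟨a, α.start_mem_support, ha0⟩
  have hpC' : p 0 ≤ M := hpC
  have hpy : p ≠ y := fun h => by rw [h] at hpC'; omega
  obtain ⟨q, hpq, γ, hγ₀⟩ := SimpleGraph.Walk.exists_eq_cons_of_ne hpy γ₀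
  have hpath₀ : (β₀.append γ₀).IsPath := by rw [← hαeq]; exact hα
  have hγ₀path : γ₀.IsPath := (isPath_append_iff'.1 hpath₀).2.1
  rw [hγ₀] at hγ₀path
  have hγpath : γ.IsPath := ((SimpleGraph.Walk.cons_isPath_iff hpq γ).1 hγ₀path).1
  have hpγ : p ∉ γ.support := ((SimpleGraph.Walk.cons_isPath_iff hpq γ).1 hγ₀path).2
  have hγsub₀ : ∀ v ∈ γ.support, v ∈ γ₀.support := fun v hv => by rw [hγ₀]; exact List.mem_cons_of_mem _ hv
  have hγsub : ∀ v ∈ γ.support, v ∈ α.support := fun v hv => by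
    rw [hαeq]; rw [SimpleGraph.Walk.mem_support_append_iff]; exact Or.inr (hγsub₀ v hv)
  -- after `p`, the walk stays off `C`, i.e. in `{v₀ > M}`, inside the trapezoid
  have hγC : ∀ v ∈ γ.support, (M : ℤ) < v 0 := by
    intro v hv
    by_contra h
    have hvC : v ∈ C := not_lt.1 h
    exact hpγ ((hplast v (hγsub₀ v hv) hvC) ▸ hv)
  have hγD : ∀ v ∈ γ.support, v ∈ trapD M := fun v hv =>
    mem_trapD_of_triNorm_le (hγC v hv) (by have := (hsupp v (hγsub v hv)).2; push_cast at this ⊢; exact this)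
  have hq0 : q 0 = (M : ℤ) + 1 := by
    have h1 := hγC q γ.start_mem_support
    have h2 := (triGraph_adj_coord hpq 0).2
    omega
  have hqI : q ∈ trapI M := mem_trapI.2 ⟨hγD q γ.start_mem_support, hq0⟩
  refine ⟨q, β₀.concat hpq, γ, ?_, hqI, hγpath, hγD, hγsub, ?_⟩
  · rw [hαeq, hγ₀, SimpleGraph.Walk.concat_eq_append, ← SimpleGraph.Walk.append_assoc, SimpleGraph.Walk.cons_append,
      SimpleGraph.Walk.nil_append]
  · refine
      { subset := fun v hv => hγD v (List.mem_toFinset.1 hv)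
        tip_mem := List.mem_toFinset.2 γ.end_mem_support
        tip_mem_J := hy
        eq_tip := fun v hv hvJ => ?_
        exists_start := ⟨q, List.mem_toFinset.2 γ.start_mem_support, hqI⟩
        conn := fun u hu v hv => ?_ }
    · -- a site of `trapO ⊆ ∂Λ_{2M}` on the clean arm is its end
      have hv' : v ∈ trapO M := hvJ
      have hv0 : v 0 = 2 * M := (mem_trapO.1 hv').2
      have hvn : triNorm v = 2 * M := by
        have h1 := (hsupp v (hγsub v (List.mem_toFinset.1 hv))).2
        have h2 : v 0 ≤ triNorm v := by
          rw [triNorm_eq_max]; exact (le_max_left _ _).trans (le_max_left _ _)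
        push_cast at h1 ⊢
        omega
      exact hclean v (hγsub v (List.mem_toFinset.1 hv)) hvn
    · have pu := (PathIn.of_walk_mem_support γ (fun w hw => Finset.mem_coe.2 (List.mem_toFinset.2 hw)) (List.mem_toFinset.1 hu)).1
      have pv := (PathIn.of_walk_mem_support γ (fun w hw => Finset.mem_coe.2 (List.mem_toFinset.2 hw)) (List.mem_toFinset.1 hv)).1
      exact pu.symm.trans pv

end Literature.Probability.Percolation
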